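import Mathlib
import Summits.ResolutionOfSingularities.ResolutionOfSingularities.Theorems.HomologicalConductorPersistenceRadical
import Summits.ResolutionOfSingularities.ResolutionOfSingularities.Theorems.HomologicalConductorPersistenceLocalStep
import Summits.ResolutionOfSingularities.ResolutionOfSingularities.Theorems.HomologicalConductorNoZenoPersistenceStep
import Summits.ResolutionOfSingularities.ResolutionOfSingularities.Theorems.HomologicalConductorNoZenoDominanceInvariance
import Summits.ResolutionOfSingularities.ResolutionOfSingularities.Theorems.HomologicalConductorNoZenoTowerNoetherian
import Summits.ResolutionOfSingularities.ResolutionOfSingularities.Theorems.HomologicalConductorPersistenceSurfaceTowerDim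
import Summits.ResolutionOfSingularities.ResolutionOfSingularities.Theorems.SyzygyFlatteningHigherRankTerminationLocAt
import Summits.ResolutionOfSingularities.ResolutionOfSingularities.Theorems.SyzygyFlatteningHigherRankTerminationTowerStageBasic
import HarnessLib

/-!
# Persistence in dimension `≤ d` from the LOCAL core at `d`-dimensional stages (rung S-2 composition)

Item `HomologicalConductor.PersistenceSurface` (stmt-ResolutionOfSingularities-19970, rung S-2 of crux
`Persistence` stmt-ResolutionOfSingularities-16484), chain W4.4b, CRUX-PLAN v3 §3.2: "glue
`PersistenceSurface_of` = r4's `step_of_local_core` restricted to dim ≤ 2 with G1". `[OURS · L1 w44b]`;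
bookkeeping over landed lemmas (no new mathematics); NOT a statement of any manuscript; AI-drafted
(weaker than expert review).

This file is the sorry-free COMPOSITION THEOREM of the dimension-`d` rung: the tower-level conclusion
`ca (T_m) ⊆ ca (T_(m+1))` (NoZeno.Birth vocabulary `ca/loc/nrm/chart/tower`, which is the route's
`let`-vocabulary) for every datum `(A, O)` with `dim A ≤ d`, from the hypothesis that the LOCAL CORE
holds at every `d`-dimensional local stage (`LocalCoreUpToDim d`, stated inline as a binder — it is
the r4 stub `stub_localChartPersistence` with the extra binder `ringKrullDim ↥B ≤ d`):

  for `B ⊆ O` local, dominated by `O` (`b ∈ B`, `b⁻¹ ∈ O` ⇒ `b⁻¹ ∈ B`), essentially of finite type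
  over `k`, `Frac B = K`, `dim B ≤ d`, and `x ∈ ca B` nonzero of minimal value:
  `x ∈ ca (loc O (nrm (B[ca B / x])))`.

* `tower_isLocalRing_and_dominated` — every stage `T_m` is a local ring dominated by `O`
  (`T_m = locAt O X` with `X ⊆ O`: `isLocalRing_locAt`, `mul_inv_mem_locAt`, `locAt_locAt`);
* `persistence_tower_of_localCore` — **the composition**: `dim A ≤ d` + local core up to dim `d`
  ⇒ `ca (T_m) ⊆ ca (T_(m+1))` for all `m` (admissible `x₀` by `di_exists_admissible`,
  `T_(m+1) = loc (nrm (T_m[ca T_m/x₀]))` by `locAt_nrm_chart_eq`, `dim T_m ≤ d` by G1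
  `ringKrullDim_tower_le_of_ringKrullDim_le`, and `x = (x x₀⁻¹) x₀` with `x x₀⁻¹ ∈ T_(m+1)`);
* `persistence_route_of_localCore` — the same with the route binders of `PersistenceSurface`
  VERBATIM for `d = 2` (`p`, `CharP k p` decorative), so that the item closes by re-abstraction of
  the route's `let`s the moment the local surface core is proved — exactly as `persistenceRadical_proof`
  closed stmt-19920 from `persistenceRadical_route`.
-/

-- single-problem summit: the doubled namespace component is forced
set_option linter.dupNamespace false

noncomputable section

namespace Summit.ResolutionOfSingularities.ResolutionOfSingularities.Theorems.HomologicalConductor.PersistenceSurfaceOfLocalCore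

open Literature.AlgebraicGeometry.Resolution (isFractionRing_subalgebra_of_le)
open Summit.ResolutionOfSingularities.ResolutionOfSingularities.Theorems.NoZeno.Birth
open Summit.ResolutionOfSingularities.ResolutionOfSingularities.Theorems.SyzygyFlattening
  (locAt isLocalRing_locAt mul_inv_mem_locAt locAt_locAt self_le_locAt)
open Summit.ResolutionOfSingularities.ResolutionOfSingularities.Theorems.HomologicalConductor.PersistenceRadical
  (ca_eq_image)
open Summit.ResolutionOfSingularities.ResolutionOfSingularities.Theorems.HomologicalConductor.PersistenceLocalStep
  (locAt_nrm_chart_eq)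
open Summit.ResolutionOfSingularities.ResolutionOfSingularities.Theorems.HomologicalConductor.PersistenceSurfaceTowerDim
  (ringKrullDim_tower_le_of_ringKrullDim_le)

variable {k K : Type} [Field k] [Field K] [Algebra k K]

/-- **Every tower stage is local and dominated by `O`.** `T_m = locAt O X` for some `X ⊆ O`
(`X = A` for `m = 0`, `X = nrm (chart O T_(m-1)) ⊆ T_m ⊆ O` otherwise), hence `T_m` is a local ring
(`isLocalRing_locAt`) and `b ∈ T_m`, `b⁻¹ ∈ O` imply `b⁻¹ = 1 · b⁻¹ ∈ locAt O T_m = T_m`.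
[folklore] -/
theorem tower_isLocalRing_and_dominated (O : ValuationSubring K) (A : Subalgebra k K)
    (hk : ∀ c : k, algebraMap k K c ∈ O) (hA : A.FG) (hfr : IsFractionRing ↥A K)
    (hAO : A.toSubring ≤ O.toSubring) (m : ℕ) :
    IsLocalRing ↥(tower O A m) ∧
      ∀ b : K, b ∈ tower O A m → b⁻¹ ∈ O → b⁻¹ ∈ tower O A m := by
  obtain ⟨X, hX, hXO⟩ : ∃ X : Subalgebra k K, tower O A m = locAt O X ∧
      X.toSubring ≤ O.toSubring := by
    cases m with
    | zero => exact ⟨A, rfl, hAO⟩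
    | succ m =>
      refine ⟨nrm (chart O (tower O A m)), rfl, ?_⟩
      obtain ⟨-, hTO, -⟩ := tn_tower_invariant O A hk hA hfr hAO (m + 1)
      intro b hb
      exact hTO (Subalgebra.mem_toSubring.mpr
        (self_le_locAt O _ (Subalgebra.mem_toSubring.mp hb)))
  rw [hX]
  refine ⟨isLocalRing_locAt O X hXO, fun b hb hbO => ?_⟩
  have h := mul_inv_mem_locAt O (locAt O X) (Subalgebra.one_mem _) hb hbO
  rwa [one_mul, locAt_locAt O X hXO] at h

/-- **Persistence along the tower in dimension `≤ d`, from the local core at stages of dimension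
`≤ d`.** Fix fields `k ⊆ K` and a valuation ring `O` of `K`. Suppose the LOCAL CORE holds at every
`k`-subalgebra `B ⊆ O` which is local, dominated by `O`, essentially of finite type with `Frac B = K`
and `dim B ≤ d`: every nonzero `x ∈ ca B` of minimal `O`-value lies in
`ca (loc O (nrm (B[ca B / x])))`. Then for every finitely generated `A ⊆ O` with `Frac A = K` and
`dim A ≤ d`, `ca (T_m) ⊆ ca (T_(m+1))` along the canonical normalised `ca`-tower, for every `m`.
[folklore] -/
theorem persistence_tower_of_localCore (O : ValuationSubring K) {d : ℕ}
    (hcore : ∀ (B : Subalgebra k K) (x : K), Algebra.EssFiniteType k ↥B → IsFractionRing ↥B K →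
      IsLocalRing ↥B → B.toSubring ≤ O.toSubring → (∀ b : K, b ∈ B → b⁻¹ ∈ O → b⁻¹ ∈ B) →
      ringKrullDim ↥B ≤ d → x ∈ ca B → x ≠ 0 → (∀ c ∈ ca B, c * x⁻¹ ∈ O) →
      x ∈ ca (loc O (nrm (Algebra.adjoin k ((B : Set K) ∪ {y : K | ∃ c ∈ ca B, y = c * x⁻¹})))))
    (A : Subalgebra k K) (hk : ∀ c : k, algebraMap k K c ∈ O) (hA : A.FG)
    (hfr : IsFractionRing ↥A K) (hAO : A.toSubring ≤ O.toSubring) (hdim : ringKrullDim ↥A ≤ d)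
    (m : ℕ) : ca (tower O A m) ⊆ ca (tower O A (m + 1)) := by
  intro x hx
  by_cases hx0 : x = 0
  · rw [hx0]
    exact zero_mem_ca _
  haveI := hfr
  obtain ⟨hAT, hTO, hET⟩ := tn_tower_invariant O A hk hA hfr hAO m
  haveI := hET
  haveI : IsNoetherianRing ↥(tower O A m) := Algebra.EssFiniteType.isNoetherianRing k _
  have hTfrac : IsFractionRing ↥(tower O A m) K := isFractionRing_subalgebra_of_le A _ hAT
  have hTO' : ∀ b ∈ tower O A m, b ∈ O := fun b hb => hTO (Subalgebra.mem_toSubring.mpr hb)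
  obtain ⟨hTloc, hTdom⟩ := tower_isLocalRing_and_dominated O A hk hA hfr hAO m
  have hTdim : ringKrullDim ↥(tower O A m) ≤ d := ringKrullDim_tower_le_of_ringKrullDim_le O A hA hdim m
  -- an admissible element of `ca (T_m)` and the local core there
  obtain ⟨x₀, hx₀, hx₀0, hadm⟩ := di_exists_admissible O (tower O A m) hTO' hx hx0
  have hstep := hcore (tower O A m) x₀ hET hTfrac hTloc hTO hTdom hTdim hx₀ hx₀0 hadm
  -- `T_(m+1) = loc O (nrm (T_m[ca T_m / x₀]))` (landed `locAt_nrm_chart_eq`, cf.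
  -- `PersistenceRadical.tower_succ_eq_loc_nrm_affChart`)
  have hsucc : tower O A (m + 1) = loc O (nrm (Algebra.adjoin k (((tower O A m) : Set K) ∪
      {y : K | ∃ c ∈ ca (tower O A m), y = c * x₀⁻¹}))) := by
    have hx₀' := hx₀
    have hadm' := hadm
    rw [ca_eq_image (tower O A m)] at hx₀' hadm'
    simp only [tower_succ, loc_eq_locAt, nrm_eq_nrm, chart]
    rw [ca_eq_image (tower O A m)]
    exact locAt_nrm_chart_eq O (tower O A m) hTO hx₀' hx₀0 hadm'
  rw [← hsucc] at hstep
  have hsplit : x = x * x₀⁻¹ * x₀ := by rw [inv_mul_cancel_right₀ hx₀0]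
  rw [hsplit]
  exact mul_mem_ca _ (ca_mul_inv_mem_tower_succ O A m hx₀ hx₀0 hadm hx) hstep

/-- **Rung S-2 (and every dimension-`d` rung) from its local core, route binders verbatim.** If the
local core holds at all local dominated essentially-finite-type stages of dimension `≤ d` (over all
fields `k ⊆ K` and valuation rings `O ⊇ k`), then for every prime `p`, all fields `k` of
characteristic `p` and `K ⊇ k`, every valuation ring `O ⊇ k`, every finitely generated `A ⊆ O` with
`Frac A = K` and `ringKrullDim ↥A ≤ d`, and every `m`: `ca (T_m) ⊆ ca (T_(m+1))` — for `d = 2` this is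
`PersistenceSurface` (stmt-ResolutionOfSingularities-19970) up to ζ/δ-reduction of the route's `let`s
(`p`, `CharP` decorative). [folklore] -/
theorem persistence_route_of_localCore (d : ℕ)
    (hcore : ∀ (k K : Type) [Field k] [Field K] [Algebra k K] (O : ValuationSubring K)
      (B : Subalgebra k K) (x : K), (∀ c : k, algebraMap k K c ∈ O) →
      Algebra.EssFiniteType k ↥B → IsFractionRing ↥B K →
      IsLocalRing ↥B → B.toSubring ≤ O.toSubring → (∀ b : K, b ∈ B → b⁻¹ ∈ O → b⁻¹ ∈ B) →
      ringKrullDim ↥B ≤ d → x ∈ ca B → x ≠ 0 → (∀ c ∈ ca B, c * x⁻¹ ∈ O) →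
      x ∈ ca (loc O (nrm (Algebra.adjoin k ((B : Set K) ∪ {y : K | ∃ c ∈ ca B, y = c * x⁻¹}))))) :
    ∀ p : ℕ, p.Prime → ∀ (k K : Type) [Field k] [CharP k p] [Field K] [Algebra k K]
      (O : ValuationSubring K) (A : Subalgebra k K), (∀ c : k, algebraMap k K c ∈ O) → A.FG →
      IsFractionRing ↥A K → A.toSubring ≤ O.toSubring → ringKrullDim ↥A ≤ d →
      ∀ m : ℕ, ca (tower O A m) ⊆ ca (tower O A (m + 1)) :=
  fun _ _ k K _ _ _ _ O A hk hA hfr hAO hdim m =>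
    persistence_tower_of_localCore O (fun B x => hcore k K O B x hk) A hk hA hfr hAO hdim m

end Summit.ResolutionOfSingularities.ResolutionOfSingularities.Theorems.HomologicalConductor.PersistenceSurfaceOfLocalCore

end
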